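import Summits.QuantumFields.YangMills.Theorems.BalabanUVNodesN08SlotOfRecordFromAlphaACMassBoundAE
import Summits.QuantumFields.YangMills.Theorems.BalabanUVNodesN08TrivialHistoryDominates

/-!
# BalabanUVNodes ∕ N08 — THE SLOT OF RECORD `Node00.PrintedUV3V N L` FROM THE (α)-AC ROWS AND THE MASS LETTER AT THE TRIVIAL HISTORY ALONE: the transport input of the
# [B10] slot in the GLOBAL-transport AC bookkeeping is ONE `dU_k`-a.e. bound on the FLOORED ITERATE of Haar under [Balaban1985Averaging] (15) — no history structure

Track A, DAG node N08 = T. Bałaban, CMP **102** (1985) 255–275 [Balaban1985UV3]: Thm 1 p. 257 (bounds (5), extensive in `|T₁^{(k)}|`), Thm 2 p. 272, (41) p. 266 (the history masses),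
(47) p. 267 + p. 272 L32–33 (the trivial term), (2) p. 256; print's averaging (2) = [Balaban1985Averaging] (15) p. 19.  Cell `pub-ymgap`, width seat `pub-ymgap-dag-n08-w1` (g6),
W-SEAT-START-LIST §n08 item 1 successor piece (o23) = file 29; `--supports` K1⁹ `StabilityBRunRowsAtRecordR13SepCoPHV` (stmt-QuantumFields-27364, KEY MAP v2; helper).  Companion of
file 28 (`…N08TrivialHistoryDominates`: `m_k(h,·) ≤ m_k(triv,·)` a.e. for every history; `ν♯ = (m_k(triv,·) − 1)·dU_k`) and of III-b (`…N08SlotOfRecordFromAlphaACMassBoundAE`: the slot from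
`RunAlphaAC` ∧ the HISTORY-UNIFORM a.e. letter ∧ the numeric window).

THE POINT.  III-b §2 asks, besides the (α)-AC rows and the window, the history-UNIFORM letter «`massRecAC … (avOfPrint N S) k h ≤ e^{c_m|T₁^{(k)}|}` `dU_k`-a.e. for EVERY history `h`,
`1 ≤ k ≤ K`»; files 23–24 relaxed it to a history-EXTENSIVE letter.  By file 28 §1 (the trivial history is the worst history) the uniform letter already follows from its instance at
`h = triv` — whose mass is the FLOORED ITERATE `f_0 = 1`, `f_{k+1} = max(1, T_k f_k)` of the reference density under (15) (`MassesAC.massRecAC_triv_succ`, `Carriers.stepWeight_triv`).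
Hence (§1–§2): **`Node00.PrintedUV3V N L` ⟸ RunAlphaAC(print-averaging AC inputs pinned to the record) ∧ «`massRecAC … (avOfPrint N S) k (Hist.triv) ≤ e^{c_m|T₁^{(k)}|}` `dU_k`-a.e.,
`1 ≤ k ≤ K`» ∧ `b₀p₀^{p₀}e^{1−p₀} ≤ εbg`**, and (§3) the transport antecedents of III-b §2 (uniform), of file 24 §4 (history-extensive, as far as sufficiency goes) and of III-b §3
(density bound on the least weakly-closed family, file 28 §2) are ONE AND THE SAME statement as this letter at the trivial history.  With file 25 (necessity: the letter at `triv`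
forces (a)′ «`T_{k−1}⋯T_0 1 ≤ e^{c_m|T₁^{(k)}|}` a.e.») the node's transport residual in this bookkeeping is EXACTLY the floored-iterate bound — necessary and sufficient.

WHAT THIS FILE PROVES (kernel; theorems only, 0 def; nothing of the paper asserted).
* §1 ★★★ `printedUV3V_at_slotOfRecord_of_alphaAC_of_trivMassBoundAE_of_consts` — III-b §2 with its ∀h antecedent replaced by the letter at `Hist.triv` (AC inputs `X` at print's averaging,
  `(X S).av = avOfPrint N S`, record minimisers above level 0; file 28's `massRecAC_le_ae_of_triv_le_ae` supplies every other history).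
* §2 ★★★ `printedUV3V_at_slotOfRecord_of_alphaAC_of_trivMassBoundAE_of_consts'` — the A6 ∃X form along file 9 §2's inhabitant (`exists_externalInputsAC_ofPrint`), the letter stated
  X-free on `MassesAC.massRecAC M₁ Rcol ε_L ε_S (avOfPrint N S) k (Hist.triv)`.
* §3 `massBoundAE_family_all_iff_triv` — on the record's family and thresholds, III-b §2's uniform antecedent ⟺ §2's antecedent (file 28 §3); `trivMassBoundAE_family_of_massBoundAE_family`
  (the converse direction is instantiation at `triv`) — so nothing was lost in §1–§2.

LOCATED READING (R4¹¹, with file 28; count-neutral; plan ∕ node00-def ∕ pub-balaban3d ∕ the n08-w3∕w6 analysis lineage decide).  N08's residual list in AC currency after g6: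
the (α)-AC rows `RunAlphaAC` at print-averaging AC inputs pinned to the record + the numeric window + ONE transport input with NO history structure — «the floored Haar iterate under
(15) obeys `f_k ≤ e^{c_m|T₁^{(k)}|}` `dU_k`-a.e., `1 ≤ k ≤ K`» (necessary by file 25 at `h = triv` — it IS `m_k(triv)`; sufficient by this file).  (a)′ is the same without the floor; E6′
would give it with `c_m = 0`.  Nothing here decides it; road (i) of (R4¹⁰) (Z-local masses, print's own (41)) remains the owners' architectural alternative.

HONEST FRAMING: count-neutral helper; the (α)-AC rows and the floored-iterate bound are HYPOTHESES = N08's object gap in AC currency; `PrintedUV3V` NOT proved; N08 NOT discharged;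
(a)′ ∕ E6′ neither used nor decided; one finite 𝕋⁴ programme at fixed ε, Bałaban AS PRINTED — R4 closes the conditional finite-𝕋⁴ rung `BalabanLadder.UV` only; the Yang–Mills mass
gap (Clay) is NOT proved by any of this; nothing continuum ∕ ℝ⁴ ∕ OS.  No `sorry`, standard axioms.
-/

noncomputable section

open MeasureTheory

namespace Summit.QuantumFields.YangMills.BalabanUVNodes.N08SlotOfRecordFromAlphaACTrivMassBound

open Literature.MathematicalPhysics.QuantumFieldTheory.Balaban1983to89
open Literature.MathematicalPhysics.QuantumFieldTheory.Balaban1983to89.Node00 (SU)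
open Literature.MathematicalPhysics.QuantumFieldTheory.Balaban1983to89.B10RunsOfRecord
open Literature.MathematicalPhysics.QuantumFieldTheory.Balaban1985CMP102
open Literature.MathematicalPhysics.QuantumFieldTheory.Balaban1985CMP102.Setting
open Literature.MathematicalPhysics.QuantumFieldTheory.Balaban1985CMP102.Theorems (Family)
open Summit.QuantumFields.Balaban3D
open Summit.QuantumFields.Balaban3D.Carriers (nblkOf StepSeries Hist rcolOf eps1Of epsSOf)
open Summit.QuantumFields.Balaban3D.Proofs
open Summit.QuantumFields.Balaban3D.Proofs.Constants (eps0Of)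
open Summit.QuantumFields.Balaban3D.Proofs.GroupModelLieC (lieC)
open Summit.QuantumFields.Balaban3D.Proofs.StandardAC (ExternalInputsAC)
open Summit.QuantumFields.Balaban3D.Proofs.MassesAC (massRecAC)
open Summit.QuantumFields.Balaban3D.Proofs.AlphaAC (AlphaDataAC RunAlphaAC)
open Summit.QuantumFields.YangMills.BalabanUVNodes.N08Thm2AsPrintedAtSlotOfRecordAC (exists_externalInputsAC_ofPrint)
open Summit.QuantumFields.YangMills.BalabanUVNodes.N08Thm2AtRecordBridgeInhabited (avgAC_avOfPrint)
open Summit.QuantumFields.YangMills.BalabanUVNodes.N08SlotOfRecordFromAlphaACMassBoundAE (printedUV3V_at_slotOfRecord_of_alphaAC_of_massBoundAE_of_consts)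
open Summit.QuantumFields.YangMills.BalabanUVNodes.N08TrivialHistoryDominates (massRecAC_le_ae_of_triv_le_ae massBound_avOfPrint_all_iff_triv)

variable {N : ℕ} [NeZero N] {L : ℕ} {𝔊 : GroupModel (SU N)} {𝔠 : Primitives.AlphaConsts L 𝔊.N} {εbg cm : ℝ}
  {X : ∀ S : Scales L, ExternalInputsAC S (SU N)}
  {𝔖 : ∀ (S : Scales L) (k : ℕ), StepSeries S (SU N) ↥(lieC 𝔊) (nblkOf S 𝔠.lane.carrier k) k}
  {𝔄 : ∀ S : Scales L, AlphaDataAC 𝔊 𝔠 (X S) (𝔖 S)}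

/-! ## §1 The slot of record from the (α)-AC rows and the letter at the trivial history -/

/-- ★★★ **THE SLOT OF RECORD `Node00.PrintedUV3V N L` FROM THE (α)-AC ROWS, THE `dU`-a.e. EXTENSIVE BOUND ON THE TRIVIAL HISTORY'S MASS ALONE, AND `b₀p₀^{p₀}e^{1−p₀} ≤ εbg`** —
AC inputs AT PRINT'S OWN AVERAGING (`(X S).av = avOfPrint N S`) pinned to the record; the bound «`massRecAC … (X S).av k (Hist.triv) U ≤ exp(c_m|T₁^{(k)}|)` for `dU_k`-a.e. `U`,
`1 ≤ k ≤ K`» on the family — the trivial history's mass being the FLOORED ITERATE `max(1, T_{k−1}[max(1, T_{k−2}[⋯])])` of the reference density under (15).  Every other history is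
dominated by it (file 28 §1, `k ≤ K ≤ m + K + 1`), so III-b §2 applies verbatim. [cite: Balaban1985UV3, Thm 1 p.257 + Thm 2 p.272 + (41) p.266 + (47) p.267; Balaban1985Averaging, (15) p.19] -/
theorem printedUV3V_at_slotOfRecord_of_alphaAC_of_trivMassBoundAE_of_consts (hav : ∀ S, (X S).av = avOfPrint N S)
    (hUk : ∀ (S : Scales L) k (V : GaugeField S.P (k + 1) (SU N)), (X S).Uk k V = UkA N (fun S => (X S).av) S (k + 1) εbg V)
    (hε : 𝔠.lane.F.b₀ * (𝔠.lane.F.p₀ ^ 𝔠.lane.F.p₀ * Real.exp (1 - 𝔠.lane.F.p₀)) ≤ εbg)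
    (R : ∀ S : Family L (eps0Of 𝔠.gamma0), RunAlphaAC 𝔊 𝔠 (X S.1) (𝔖 S.1) (𝔄 S.1)) (hcm : 0 ≤ cm)
    (htriv : ∀ S : Family L (eps0Of 𝔠.gamma0), ∀ k, 1 ≤ k → k ≤ S.1.K → ∀ᵐ U ∂(fieldMeasure S.1.P k (SU N)),
      massRecAC 𝔠.lane.carrier.M₁ (rcolOf S.1 𝔠.lane.carrier) (eps1Of S.1 𝔠.lane.carrier) (epsSOf S.1 𝔠.lane.carrier) (X S.1).av k (Hist.triv S.1.P k) U ≤
        Real.exp (cm * S.1.sites k)) :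
    Node00.PrintedUV3V N L := by
  refine printedUV3V_at_slotOfRecord_of_alphaAC_of_massBoundAE_of_consts (𝔄 := 𝔄) hav hUk hε R hcm fun S k hk1 hkK h => ?_
  have hX : (X S.1).av = avOfPrint N S.1 := hav S.1
  have ht := htriv S k hk1 hkK
  rw [hX] at ht ⊢
  exact massRecAC_le_ae_of_triv_le_ae 𝔠.lane.carrier.M₁ (rcolOf S.1 𝔠.lane.carrier) (eps1Of S.1 𝔠.lane.carrier) (epsSOf S.1 𝔠.lane.carrier) (avOfPrint N S.1)
    (avgAC_avOfPrint N L S.1) (by show k ≤ S.1.m + S.1.K + 1; omega) ht h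

/-! ## §2 The A6 form: print-averaging AC inputs pinned to the record exist -/

variable (N L) in
/-- ★★★ **THE SLOT OF RECORD FROM ITS AC RESIDUALS WITH THE TRANSPORT INPUT STATED AT THE TRIVIAL HISTORY ONLY — A6 FORM** (file 9 §2's inhabitant: AC external inputs AT PRINT'S
AVERAGING with the record's classes and minimisers EXIST): for every `SU(N)`, `𝔠`, `εbg` with `b₀p₀^{p₀}e^{1−p₀} ≤ εbg`, `c_m ≥ 0`, THERE ARE such inputs `X`, and for every expansion data `𝔖`
and (α)-AC data `𝔄` over them, **the (α)-AC rows on the family ∧ «`massRecAC M₁ Rcol ε_L ε_S (avOfPrint N S) k (Hist.triv) ≤ exp(c_m|T₁^{(k)}|)` `dU_k`-a.e., `1 ≤ k ≤ K`» ⇒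
`Node00.PrintedUV3V N L`** — III-b's `…_of_consts'` with the history-uniform antecedent replaced by ONE a.e. bound on the floored Haar iterate under (15): no history, no Z-budget, no
E6′, no pointwise statement about a Radon–Nikodym version. [cite: Balaban1985UV3, Thm 1 p.257 + Thm 2 p.272 + (41) p.266 + (47) p.267; Balaban1985Averaging, (15) p.19] -/
theorem printedUV3V_at_slotOfRecord_of_alphaAC_of_trivMassBoundAE_of_consts' (𝔊 : GroupModel (SU N)) (𝔠 : Primitives.AlphaConsts L 𝔊.N) (εbg cm : ℝ)
    (hε : 𝔠.lane.F.b₀ * (𝔠.lane.F.p₀ ^ 𝔠.lane.F.p₀ * Real.exp (1 - 𝔠.lane.F.p₀)) ≤ εbg) (hcm : 0 ≤ cm) :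
    ∃ X : ∀ S : Scales L, ExternalInputsAC S (SU N), (∀ S, (X S).av = avOfPrint N S) ∧
      ∀ (𝔖 : ∀ (S : Scales L) (k : ℕ), StepSeries S (SU N) ↥(lieC 𝔊) (nblkOf S 𝔠.lane.carrier k) k)
        (𝔄 : ∀ S : Scales L, AlphaDataAC 𝔊 𝔠 (X S) (𝔖 S)),
        (∀ S : Family L (eps0Of 𝔠.gamma0), RunAlphaAC 𝔊 𝔠 (X S.1) (𝔖 S.1) (𝔄 S.1)) →
        (∀ S : Family L (eps0Of 𝔠.gamma0), ∀ k, 1 ≤ k → k ≤ S.1.K → ∀ᵐ U ∂(fieldMeasure S.1.P k (SU N)),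
          massRecAC 𝔠.lane.carrier.M₁ (rcolOf S.1 𝔠.lane.carrier) (eps1Of S.1 𝔠.lane.carrier) (epsSOf S.1 𝔠.lane.carrier) (avOfPrint N S.1) k (Hist.triv S.1.P k) U ≤
            Real.exp (cm * S.1.sites k)) →
        Node00.PrintedUV3V N L := by
  obtain ⟨X, hav, -, hUk⟩ := exists_externalInputsAC_ofPrint N L εbg
  refine ⟨X, hav, fun 𝔖 𝔄 R htriv => printedUV3V_at_slotOfRecord_of_alphaAC_of_trivMassBoundAE_of_consts (𝔄 := 𝔄) hav hUk hε R hcm fun S k hk1 hkK => ?_⟩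
  have hX : (X S.1).av = avOfPrint N S.1 := hav S.1
  rw [hX]
  exact htriv S k hk1 hkK

/-! ## §3 Nothing is lost: the uniform antecedent of III-b §2 and the trivial-history antecedent of §2 are equivalent on the family -/

/-- **ON THE RECORD'S FAMILY AND THRESHOLDS, III-b §2's history-UNIFORM a.e. letter ⟺ §2's letter at the trivial history** (levelwise file 28 §3; `k ≤ K ≤ K + 1`). [cite: Balaban1985UV3, (5) p.257 + (41) p.266 + (47) p.267; Balaban1985Averaging, (15) p.19] -/
theorem massBoundAE_family_all_iff_triv (𝔠 : Primitives.AlphaConsts L 𝔊.N) (cm : ℝ) :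
    (∀ S : Family L (eps0Of 𝔠.gamma0), ∀ k, 1 ≤ k → k ≤ S.1.K → ∀ h : Hist S.1.P k, ∀ᵐ U ∂(fieldMeasure S.1.P k (SU N)),
        massRecAC 𝔠.lane.carrier.M₁ (rcolOf S.1 𝔠.lane.carrier) (eps1Of S.1 𝔠.lane.carrier) (epsSOf S.1 𝔠.lane.carrier) (avOfPrint N S.1) k h U ≤
          Real.exp (cm * S.1.sites k)) ↔
      ∀ S : Family L (eps0Of 𝔠.gamma0), ∀ k, 1 ≤ k → k ≤ S.1.K → ∀ᵐ U ∂(fieldMeasure S.1.P k (SU N)),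
        massRecAC 𝔠.lane.carrier.M₁ (rcolOf S.1 𝔠.lane.carrier) (eps1Of S.1 𝔠.lane.carrier) (epsSOf S.1 𝔠.lane.carrier) (avOfPrint N S.1) k (Hist.triv S.1.P k) U ≤
          Real.exp (cm * S.1.sites k) := by
  refine ⟨fun H S k hk1 hkK => H S k hk1 hkK _, fun H S k hk1 hkK => ?_⟩
  exact (massBound_avOfPrint_all_iff_triv N S.1 𝔠.lane.carrier.M₁ (rcolOf S.1 𝔠.lane.carrier) (eps1Of S.1 𝔠.lane.carrier) (epsSOf S.1 𝔠.lane.carrier)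
    (by omega) (fun _ => Real.exp (cm * S.1.sites k))).2 (H S k hk1 hkK)

/-- **… in particular the trivial-history letter is NECESSARY for III-b §2's antecedent** (instantiate at `Hist.triv`) — so §1–§2 lose nothing against III-b, and by file 25
(`iteratedTransport_le_exp_ae_of_massBound_avOfPrint`) both force (a)′. [cite: Balaban1985UV3, (41) p.266 + (47) p.267; Balaban1985Averaging, (15) p.19] -/
theorem trivMassBoundAE_family_of_massBoundAE_family (𝔠 : Primitives.AlphaConsts L 𝔊.N) (cm : ℝ)
    (H : ∀ S : Family L (eps0Of 𝔠.gamma0), ∀ k, 1 ≤ k → k ≤ S.1.K → ∀ h : Hist S.1.P k, ∀ᵐ U ∂(fieldMeasure S.1.P k (SU N)),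
        massRecAC 𝔠.lane.carrier.M₁ (rcolOf S.1 𝔠.lane.carrier) (eps1Of S.1 𝔠.lane.carrier) (epsSOf S.1 𝔠.lane.carrier) (avOfPrint N S.1) k h U ≤
          Real.exp (cm * S.1.sites k)) :
    ∀ S : Family L (eps0Of 𝔠.gamma0), ∀ k, 1 ≤ k → k ≤ S.1.K → ∀ᵐ U ∂(fieldMeasure S.1.P k (SU N)),
      massRecAC 𝔠.lane.carrier.M₁ (rcolOf S.1 𝔠.lane.carrier) (eps1Of S.1 𝔠.lane.carrier) (epsSOf S.1 𝔠.lane.carrier) (avOfPrint N S.1) k (Hist.triv S.1.P k) U ≤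
        Real.exp (cm * S.1.sites k) :=
  (massBoundAE_family_all_iff_triv (N := N) 𝔠 cm).1 H

end Summit.QuantumFields.YangMills.BalabanUVNodes.N08SlotOfRecordFromAlphaACTrivMassBound

end
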